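import Literature.AlgebraicGeometry.Shioda1981.ConditionQTwentyFive
import Literature.AlgebraicGeometry.HodgeTheory.FermatFourfoldFiveStandardSextuples
import Summits.HodgeConjecture.HodgeConjecture.Theorems.PadicSemiregularLiftHodgeFermatVarietiesLevelRaise
import HarnessLib

/-!
# `M'ₘ` is symmetric for `m` prime to `6` — Shioda's 1981 symmetry argument, uniformly, from two printed theorems (part 1 of 2)

HONEST FRAMING: explicit algebraic cycles for specific Hodge classes on Fermat/Delsarte varieties;
residual open instances listed; no claim on general Hodge.

Topic path `Summits/HodgeConjecture/FermatCycles/` of cell `pub-hfermat` (new work, not literature: a structural by-product of the cell's `(Q⁴ₘ)`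
table, found from the kernel certificates `ConditionQObstruction*.lean` — at every FALSE level `5p ≤ 100` the separating functional is an
ASYMMETRY `e₋ₓ − eₓ`, and a check by two implementations (`code/lit/q4/symtest.py`, `sepfunc2.py`) showed that at `m = 25, 35, 55, 65, 85, 95` EVERY
generator of Shioda's `M'ₘ` is symmetric, exactly as in Shioda's printed proof for `m = 25` [Shioda1981FermatType, Appendix]).

THE ARGUMENT (ours; the two inputs are printed theorems, taken here as HYPOTHESES spelled out in the tree's vocabulary — nothing is vendored as a fact).
Let `gcd(m, 6) = 1`.
* INPUT 1 = [Shioda1982PicardFermat] Theorem K-R (a), p. 730 (= [KoblitzRohrlich1978] Thm 1 (i)): for `β, γ ∈ 𝔄^{1,0}ₘ` (triples of non-zero residues with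
  `⟨b₀⟩ + ⟨b₁⟩ + ⟨b₂⟩ = m`) with `H_β = H_γ` (`H_β = {t ∈ (ℤ/m)ˣ : |t·β| = 1}`), `β` is a permutation of `γ`. Hypothesis `hKR` below.
* INPUT 2 = [Shioda1982PicardFermat] Theorem 6 (a), p. 731: there are no indecomposable elements of `𝔅²ₘ` — every Hodge quadruple has two entries
  summing to `0` (§2 p. 726), i.e. is `{a, −a} + {b, −b}`. Hypothesis `h6a` below.
* STEP (`mPrime_symmetric`): every element of `M'ₘ = ⟨pairs, Hodge quadruples, semi-decomposable Hodge sextuples⟩` is SYMMETRIC (`x_ν = x_{m−ν}`, the tree's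
  `Shioda1981.IsSymmetric`). Pairs and (by INPUT 2) quadruples are; a semi-decomposable Hodge sextuple is `T₁ + T₂` with zero-sum triples `Tᵢ` of
  non-zero residues, and Shioda's equations (2) for `T₁ + T₂` say `|tT₁| + |tT₂| = 3` for every unit `t`, i.e. `H_{T₂} = H_{−T₁}` (after arranging
  `|T₂| = 1`); INPUT 1 gives `T₂ = −T₁` as multisets (`semi_eq_add_neg`), so `T₁ + T₂` is symmetric.
* CONSEQUENCES (this file): a NON-symmetric Hodge multiset is not `ξ₁ − ξ₂` with `ξᵢ ∈ M'ₘ` (`not_stablyMem_of_not_symmetric`), so it refutes `(Qₘ)`,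
  and `(Q⁴ₘ)` if it has `6` elements (`not_conditionQ_four_of_not_symmetric`). PART 2 (`ConditionQCoprimeSix.lean`): for `5 ∣ m`, `m ≥ 15`, Aoki's standard sextuple
  `σ₅ = {1, 1+d, 1+2d, 1+3d, 1+4d, −5}` (`d = m/5`; Hodge by the tree's `isHodgeMultiset_fiveStandard`, [Aoki1987] Thm 1-1) contains `1` but not `−1`
  (`neg_one_not_mem_fiveStandard`), hence **`not_conditionQ_four_of_five_dvd`: `(Q⁴ₘ)` FAILS for every `m` prime to `6` with `5 ∣ m`, `m ≥ 25`** — granted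
  the two inputs at that `m` — in particular for `m = 5p`, `p ≥ 5` prime, and `m = 25, 35, 55, 65, 85, 95, 115, 125, 145, …`; the kernel certificates of
  the cell at `25, 35, 55, 65, 85, 95` are its first instances, Shioda's Appendix (`m = 25`) its prototype.
* PART 2 also derives `(Qₘ) ⟺ m prime` for `gcd(m, 6) = 1` from the same inputs (`conditionQAll_iff_prime`): Shioda's question (Math. Ann. 245
  p. 184, "(Qₘ) but not (Pₘ)?") has a negative answer throughout `gcd(m, 6) = 1`, consistent with the cell's table (all twenty `(Q⁴) ∧ ¬(P⁴)` levels are even).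

References: [Shioda1982PicardFermat] T. Shioda, On the Picard number of a Fermat surface, J. Fac. Sci. Univ. Tokyo IA 28 (1982) 725–734, Thm K-R p. 730,
§2 p. 726, Thm 6 p. 731 (scan read, `HOME/lit/scans/Shioda1982/`); [KoblitzRohrlich1978] N. Koblitz, D. Rohrlich, Canad. J. Math. 30 (1978) 1183–1205,
Thm 1 p. 1185; [Shioda1981FermatType] T. Shioda, Math. Ann. 258 (1981), Appendix pp. 78–79; [Shioda1979HodgeFermat] T. Shioda, Math. Ann. 245 (1979) §4
pp. 183–184; [Aoki1987] N. Aoki, J. Math. Soc. Japan 39 (1987) Thm 1-1.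
-/

namespace Summit.HodgeConjecture.FermatCycles.ConditionQSymmetric

open Multiset
open Literature.AlgebraicGeometry.HodgeTheory Literature.AlgebraicGeometry.HodgeTheory.FermatCharacter
open Literature.AlgebraicGeometry.Shioda1979 Literature.AlgebraicGeometry.Shioda1981

variable {m : ℕ}

/-! ### Symmetric multisets (small API; the Literature file's lemmas are private) -/

/-- `0` is symmetric. [folklore] -/
theorem isSymmetric_zero : IsSymmetric (0 : Multiset (ZMod m)) := fun x ↦ by simp

/-- Sums of symmetric multisets are symmetric. [folklore] -/
theorem isSymmetric_add {s t : Multiset (ZMod m)} (hs : IsSymmetric s) (ht : IsSymmetric t) : IsSymmetric (s + t) :=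
  fun x ↦ by rw [count_add, count_add, hs x, ht x]

/-- Cancellation: `s + t` and `t` symmetric ⇒ `s` symmetric. [folklore] -/
theorem isSymmetric_of_add_right {s t : Multiset (ZMod m)} (hst : IsSymmetric (s + t)) (ht : IsSymmetric t) : IsSymmetric s :=
  fun x ↦ by have h := hst x; rw [count_add, count_add, ht x] at h; omega

/-- A pair `{a, −a}` is symmetric. [cite: Shioda1979HodgeFermat, §3 p. 180 (Mₘ(1))] -/
theorem isSymmetric_pair (a : ZMod m) : IsSymmetric ({a, -a} : Multiset (ZMod m)) := by
  intro x
  simp only [insert_eq_cons, count_cons, count_singleton, neg_eq_iff_eq_neg, neg_neg]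
  exact Nat.add_comm _ _

/-- `t + (−t)` is symmetric. [folklore] -/
theorem isSymmetric_add_map_neg (t : Multiset (ZMod m)) : IsSymmetric (t + t.map fun a ↦ -a) := by
  intro x
  have h1 : count x (t.map fun a ↦ -a) = count (-x) t := by
    conv_lhs => rw [show x = -(-x) from (neg_neg x).symm]
    exact count_map_eq_count' _ _ neg_injective _
  have h2 : count (-x) (t.map fun a ↦ -a) = count x t := by
    exact count_map_eq_count' _ _ neg_injective _
  rw [count_add, count_add, h1, h2, Nat.add_comm]

/-! ### Norms of zero-sum multisets of non-zero residues -/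

/-- Bounds: `card s ≤ Σ ⟨a⟩ ≤ (m−1)·card s` for non-zero residues. [folklore] -/
theorem mNormSum_bounds [NeZero m] {s : Multiset (ZMod m)} (h0 : ∀ a ∈ s, a ≠ 0) :
    card s ≤ mNormSum s ∧ mNormSum s + card s ≤ m * card s := by
  induction s using Multiset.induction with
  | empty => simp [mNormSum_zero]
  | cons a s ih =>
    have ha : a ≠ 0 := h0 a (mem_cons_self a s)
    have ih' := ih fun b hb ↦ h0 b (mem_cons_of_mem hb)
    have h1 : 1 ≤ a.val := Nat.one_le_iff_ne_zero.mpr fun e ↦ ha ((ZMod.val_eq_zero a).mp e)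
    have h2 := ZMod.val_lt a
    rw [mNormSum_cons, card_cons, Nat.mul_succ]
    constructor
    · omega
    · omega

/-- A zero-sum triple of non-zero residues has `Σ ⟨a⟩ ∈ {m, 2m}` (`|T| ∈ {1, 2}`). [cite: Shioda1982PicardFermat, §5 p. 730] -/
theorem mNormSum_triple [NeZero m] {s : Multiset (ZMod m)} (h0 : ∀ a ∈ s, a ≠ 0) (hs : s.sum = 0) (h3 : card s = 3) :
    mNormSum s = m ∨ mNormSum s = 2 * m := by
  obtain ⟨k, hk⟩ :=
    Summit.HodgeConjecture.HodgeConjecture.Theorems.CancelByAnyClaimLattice.dvd_mNormSum_of_sum_eq_zero hs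
  have hb := mNormSum_bounds h0
  rw [h3] at hb
  have hm : 0 < m := Nat.pos_of_ne_zero (NeZero.ne m)
  have hk1 : 1 ≤ k := by
    rcases Nat.eq_zero_or_pos k with rfl | hk0
    · omega
    · exact hk0
  have hk2 : k ≤ 2 := by
    rcases Nat.lt_or_ge k 3 with h | h
    · omega
    · have : m * 3 ≤ m * k := Nat.mul_le_mul_left m h
      omega
  interval_cases k
  · left; omega
  · right; omega

/-- `Σ ⟨−a⟩ = m·#s − Σ ⟨a⟩` for non-zero residues. [folklore] -/
theorem mNormSum_map_neg [NeZero m] {s : Multiset (ZMod m)} (h0 : ∀ a ∈ s, a ≠ 0) :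
    mNormSum (s.map fun a ↦ -a) + mNormSum s = m * card s := by
  induction s using Multiset.induction with
  | empty => simp [mNormSum_zero]
  | cons a s ih =>
    have ha : a ≠ 0 := h0 a (mem_cons_self a s)
    have ih' := ih fun b hb ↦ h0 b (mem_cons_of_mem hb)
    have h1 : 1 ≤ a.val := Nat.one_le_iff_ne_zero.mpr fun e ↦ ha ((ZMod.val_eq_zero a).mp e)
    have h2 := ZMod.val_lt a
    have hneg : (-a).val = m - a.val := by
      rw [ZMod.neg_val' a, Nat.mod_eq_of_lt (by omega)]
    rw [map_cons, mNormSum_cons, mNormSum_cons, card_cons, hneg, Nat.mul_succ]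
    omega

/-- Multiplying by a unit preserves "zero-sum multiset of non-zero residues". [folklore] -/
theorem unit_smul_props [NeZero m] {s : Multiset (ZMod m)} (h0 : ∀ a ∈ s, a ≠ 0) (hs : s.sum = 0) (t : (ZMod m)ˣ) :
    (∀ a ∈ s.map (fun a ↦ (t : ZMod m) * a), a ≠ 0) ∧ (s.map fun a ↦ (t : ZMod m) * a).sum = 0 := by
  refine ⟨fun a ha ↦ ?_, by rw [Multiset.sum_map_mul_left, Multiset.map_id', hs, mul_zero]⟩
  obtain ⟨b, hb, rfl⟩ := Multiset.mem_map.mp ha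
  exact fun e ↦ h0 b hb (by simpa using (t.isUnit.mul_right_eq_zero).mp e)

/-! ### The two printed inputs, as hypotheses (section variables; no `Prop` is defined or vendored here)

* `hKR` = [Shioda1982PicardFermat] Theorem K-R (a) p. 730 (= [KoblitzRohrlich1978] Thm 1 (i)), in the tree's vocabulary: two triples of non-zero
  residues with `Σ ⟨bᵢ⟩ = m` and the same `H = {t : Σ ⟨t bᵢ⟩ = m}` coincide as multisets — a THEOREM in print when `gcd(m, 6) = 1`;
* `h6a` = [Shioda1982PicardFermat] Theorem 6 (a) p. 731 with the definition of "decomposable" of §2 p. 726: every Hodge quadruple has two entries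
  summing to zero, i.e. is `{a, −a} + {b, −b}` — a THEOREM in print when `gcd(m, 6) = 1` (Shioda deduces it from Thm K-R (a) and his Prop. 5;
  that deduction is not repeated here). -/

section Inputs

variable (hKR : ∀ β γ : Multiset (ZMod m), card β = 3 → card γ = 3 → (∀ x ∈ β, x ≠ 0) → (∀ x ∈ γ, x ≠ 0) →
    mNormSum β = m → mNormSum γ = m →
    (∀ t : (ZMod m)ˣ, mNormSum (β.map fun a ↦ (t : ZMod m) * a) = m ↔ mNormSum (γ.map fun a ↦ (t : ZMod m) * a) = m) → β = γ)
  (h6a : ∀ q : Multiset (ZMod m), IsHodgeMultiset q → card q = 4 → ∃ a b : ZMod m, q = {a, -a} + {b, -b})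

/-! ### The step: semi-decomposable Hodge sextuples are `T + (−T)`; `M'ₘ` is symmetric -/

include hKR

/-- Under INPUT 1: if `t + u` is a Hodge sextuple with `t, u` zero-sum triples, then `u = −t`. [cite: Shioda1982PicardFermat, Prop. 5 and Thm K-R (a), p. 730] -/
theorem semi_eq_map_neg [NeZero m] {t u : Multiset (ZMod m)} (ht3 : card t = 3) (hu3 : card u = 3)
    (hts : t.sum = 0) (hH : IsHodgeMultiset (t + u)) : u = t.map fun a ↦ -a := by
  obtain ⟨⟨h0, -⟩, hnorm⟩ := hH
  have h0t : ∀ a ∈ t, a ≠ 0 := fun a ha ↦ h0 a (mem_add.mpr (Or.inl ha))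
  have h0u : ∀ a ∈ u, a ≠ 0 := fun a ha ↦ h0 a (mem_add.mpr (Or.inr ha))
  -- Shioda's equations (2) for `t + u`: `Σ⟨w t⟩ + Σ⟨w u⟩ = 3m` for every unit `w`
  have hsum : ∀ w : (ZMod m)ˣ,
      mNormSum (t.map fun a ↦ (w : ZMod m) * a) + mNormSum (u.map fun a ↦ (w : ZMod m) * a) = 3 * m := by
    intro w
    have e := hnorm w
    rw [Multiset.map_add, mNormSum_add, card_add, ht3, hu3] at e
    omega
  -- each summand is `m` or `2m`
  have htri : ∀ w : (ZMod m)ˣ, mNormSum (t.map fun a ↦ (w : ZMod m) * a) = m ∨ mNormSum (t.map fun a ↦ (w : ZMod m) * a) = 2 * m :=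
    fun w ↦ mNormSum_triple (unit_smul_props h0t hts w).1 (unit_smul_props h0t hts w).2 (by rw [card_map, ht3])
  have h0tn : ∀ a ∈ t.map (fun a ↦ -a), a ≠ 0 := by
    intro a ha; obtain ⟨b, hb, rfl⟩ := Multiset.mem_map.mp ha; exact neg_ne_zero.mpr (h0t b hb)
  have h0un : ∀ a ∈ u.map (fun a ↦ -a), a ≠ 0 := by
    intro a ha; obtain ⟨b, hb, rfl⟩ := Multiset.mem_map.mp ha; exact neg_ne_zero.mpr (h0u b hb)
  -- norms of `w·(−t)` versus `w·t`
  have hneg : ∀ (s : Multiset (ZMod m)), (∀ a ∈ s, a ≠ 0) → card s = 3 → ∀ w : (ZMod m)ˣ,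
      mNormSum ((s.map fun a ↦ -a).map fun a ↦ (w : ZMod m) * a) + mNormSum (s.map fun a ↦ (w : ZMod m) * a) = 3 * m := by
    intro s hs0 hs3 w
    have e1 : ((s.map fun a ↦ -a).map fun a ↦ (w : ZMod m) * a) = (s.map fun a ↦ (w : ZMod m) * a).map (fun a ↦ -a) := by
      rw [Multiset.map_map, Multiset.map_map]; exact Multiset.map_congr rfl fun a _ ↦ by simp [mul_neg]
    rw [e1]
    have h0w : ∀ a ∈ s.map (fun a ↦ (w : ZMod m) * a), a ≠ 0 := by
      intro a ha; obtain ⟨b, hb, rfl⟩ := Multiset.mem_map.mp ha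
      exact fun e ↦ hs0 b hb (by simpa using (w.isUnit.mul_right_eq_zero).mp e)
    have := mNormSum_map_neg h0w
    rw [card_map, hs3] at this
    omega
  rcases mNormSum_triple h0t hts ht3 with ht1 | ht2
  · -- `|t| = 1`, `|u| = 2`: apply K-R to `β = −u`, `γ = t`
    have hu2 : mNormSum u = 2 * m := by
      have e := hsum 1; simp only [Units.val_one, one_mul, Multiset.map_id'] at e; omega
    have hβ : mNormSum (u.map fun a ↦ -a) = m := by
      have := mNormSum_map_neg h0u; rw [hu3] at this; omega
    have key : u.map (fun a ↦ -a) = t := by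
      refine hKR _ _ (by rw [card_map, hu3]) ht3 h0un h0t hβ ht1 fun w ↦ ?_
      have e1 := hneg u h0u hu3 w
      have e2 := hsum w
      have e3 := htri w
      constructor <;> intro h <;> omega
    rw [← key, Multiset.map_map]
    simp
  · -- `|t| = 2`, `|u| = 1`: apply K-R to `β = −t`, `γ = u`
    have hu1 : mNormSum u = m := by
      have e := hsum 1; simp only [Units.val_one, one_mul, Multiset.map_id'] at e; omega
    have hβ : mNormSum (t.map fun a ↦ -a) = m := by
      have := mNormSum_map_neg h0t; rw [ht3] at this; omega
    symm
    refine hKR _ _ (by rw [card_map, ht3]) hu3 h0tn h0u hβ hu1 fun w ↦ ?_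
    have e1 := hneg t h0t ht3 w
    have e2 := hsum w
    have e3 := htri w
    constructor <;> intro h <;> omega

include h6a

/-- **`M'ₘ` is symmetric** under the two inputs: every element of the monoid generated by the pairs, the Hodge quadruples and the semi-decomposable
Hodge sextuples has symmetric multiplicities `x_ν = x_{m−ν}` — Shioda's Appendix argument for `m = 25`, uniformly.
[cite: Shioda1981FermatType, Appendix pp. 78–79] [cite: Shioda1982PicardFermat, Thm K-R (a) p. 730, Thm 6 (a) p. 731] -/
theorem mPrime_symmetric [NeZero m] : ∀ ξ ∈ MPrime m, IsSymmetric ξ := by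
  intro ξ hξ
  induction hξ using AddSubmonoid.closure_induction with
  | mem g hg =>
    obtain ⟨hH, h2 | hq | ⟨-, t, u, ht3, hu3, hts, -, rfl⟩⟩ := hg
    · obtain ⟨a, -, rfl⟩ := hH.eq_pair_of_card_eq_two h2
      exact isSymmetric_pair a
    · obtain ⟨a, b, rfl⟩ := h6a g hH hq
      exact isSymmetric_add (isSymmetric_pair a) (isSymmetric_pair b)
    · rw [semi_eq_map_neg hKR ht3 hu3 hts hH]
      exact isSymmetric_add_map_neg t
  | zero => exact isSymmetric_zero
  | add x y _ _ hx hy => exact isSymmetric_add hx hy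

/-! ### Consequences: non-symmetric Hodge multisets refute `(Qₘ)` -/

/-- A non-symmetric multiset is not stably in `M'ₘ`. [cite: Shioda1979HodgeFermat, §4 condition (Qⁿₘ), pp. 183–184] -/
theorem not_stablyMem_of_not_symmetric [NeZero m] {s : Multiset (ZMod m)} (hns : ¬ IsSymmetric s) :
    ¬ ∃ ξ₁ ∈ MPrime m, ∃ ξ₂ ∈ MPrime m, s + ξ₂ = ξ₁ := by
  rintro ⟨ξ₁, h₁, ξ₂, h₂, heq⟩
  have hs1 := mPrime_symmetric hKR h6a ξ₁ h₁
  rw [← heq] at hs1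
  exact hns (isSymmetric_of_add_right hs1 (mPrime_symmetric hKR h6a ξ₂ h₂))

/-- A non-symmetric Hodge sextuple refutes `(Q⁴ₘ)`. [cite: Shioda1979HodgeFermat, §4 condition (Qⁿₘ), pp. 183–184] -/
theorem not_conditionQ_four_of_not_symmetric [NeZero m] {s : Multiset (ZMod m)}
    (hs : IsHodgeMultiset s) (h6 : card s = 6) (hns : ¬ IsSymmetric s) : ¬ ConditionQ m 4 := fun hQ ↦
  not_stablyMem_of_not_symmetric hKR h6a hns (hQ s hs (by omega) (by omega))

/-- A non-symmetric Hodge multiset refutes `(Qₘ)` (all lengths). [cite: Shioda1979HodgeFermat, §4 condition (Qₘ), p. 183] -/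
theorem not_conditionQAll_of_not_symmetric [NeZero m] {s : Multiset (ZMod m)}
    (hs : IsHodgeMultiset s) (hns : ¬ IsSymmetric s) : ¬ ConditionQAll m := fun hQ ↦
  not_stablyMem_of_not_symmetric hKR h6a hns (hQ s hs)

end Inputs

end Summit.HodgeConjecture.FermatCycles.ConditionQSymmetric
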